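import Mathlib

/-!
# Pointwise minorants of the Bombieri integrand on `(0, t₁]` and `[t₁, t₂]`

Stub `stub_regionOneTwo` of the line `Sketch` (crux stmt-RiemannHypothesis-16305,
`SignCone.SignConeFarField`).

With `A = Re F(0)`, `σ = Re F(x) + Re F(-x)` and
`h(A, σ, x) = σ (e^{-x/2} + e^{x/2}) − (e^{x/2} σ − 2A) / (2 sinh x)`,
we prove the two pointwise lower bounds
* `h ≥ (97/28)·A` for `0 < x ≤ t₁ = 4 log(15/14)`, `σ ≤ 2A`, `A ≥ 0`;
* `h ≥ (279/100)·A` for `t₁ ≤ x ≤ t₂ = 2 log(7/6)`, `|σ| ≤ 2A`.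

Method.  Substitute `E = e^{x/2}` (`e^{-x/2} = E⁻¹`, `sinh x = (E⁴ − 1)/(2E²)`); then for any
constant `c`,
`h − c·A = (σ (E⁶ − E² − 1) + 2A E³ − c A E (E⁴ − 1)) / (E (E⁴ − 1))`,
and the numerator is controlled by elementary polynomial estimates in `t = E − 1`:
on region one `t ∈ (0, 29/196]` and `E⁶ − E² − 1 ≤ 0` (Bombieri's weight is nonpositive below
the plastic number), so `σ ≤ 2A` may be inserted; on region two `t ∈ (0, 1/6]` and the numerator
is affine in `σ ∈ [−2A, 2A]`, so it suffices to check the two endpoints.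
-/

noncomputable section

-- `Summit.RiemannHypothesis.RiemannHypothesis.…` repeats a namespace component by design.
set_option linter.dupNamespace false

namespace Summit.RiemannHypothesis.RiemannHypothesis.Theorems.SignConeFarField

/-- The substitution `E = exp (x/2)` in `sinh`: `sinh x = (E⁴ - 1) / (2 E²)`. -/
private lemma sinh_via_exp_half (x : ℝ) :
    Real.sinh x = (Real.exp (x / 2) ^ 4 - 1) / (2 * Real.exp (x / 2) ^ 2) := by
  have h2 : Real.exp x = Real.exp (x / 2) ^ 2 := by
    rw [← Real.exp_nat_mul]; congr 1; push_cast; ring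
  have hE : Real.exp (x / 2) ≠ 0 := (Real.exp_pos _).ne'
  rw [Real.sinh_eq, Real.exp_neg, h2]
  field_simp

/-- Clearing denominators after the substitution `E = exp (x/2)`:
`h − c·A = (σ (E⁶ − E² − 1) + 2A E³ − c A E (E⁴ − 1)) / (E (E⁴ − 1))`. -/
private lemma key_identity (A σ E c : ℝ) (hE : 1 < E) :
    σ * (E⁻¹ + E) - (E * σ - 2 * A) / (2 * ((E ^ 4 - 1) / (2 * E ^ 2))) - A * c =
      (σ * (E ^ 6 - E ^ 2 - 1) + 2 * A * E ^ 3 - c * A * (E * (E ^ 4 - 1))) /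
        (E * (E ^ 4 - 1)) := by
  have hE0 : E ≠ 0 := (show (0 : ℝ) < E by linarith).ne'
  have h4 : E ^ 4 - 1 ≠ 0 := (sub_pos.2 (one_lt_pow₀ hE (by norm_num))).ne'
  field_simp
  ring

/-- Region one (`1 ≤ E ≤ 225/196 = (15/14)²`): `E⁶ − E² − 1 ≤ 0`, i.e. Bombieri's weight is
nonpositive (the plastic-number threshold is `E² = 1.3247…`, here `E² ≤ 1.3179`). -/
private lemma weightNum_nonpos (E : ℝ) (h1 : 1 ≤ E) (h2 : E ≤ 225 / 196) :
    E ^ 6 - E ^ 2 - 1 ≤ 0 := by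
  obtain ⟨t, rfl⟩ : ∃ t, E = 1 + t := ⟨E - 1, by ring⟩
  have ht0 : 0 ≤ t := by linarith
  have ht1 : t ≤ 29 / 196 := by linarith
  have ht2 : t ^ 2 ≤ (29 / 196) ^ 2 := pow_le_pow_left₀ ht0 ht1 2
  have ht3 : t ^ 3 ≤ (29 / 196) ^ 3 := pow_le_pow_left₀ ht0 ht1 3
  have ht4 : t ^ 4 ≤ (29 / 196) ^ 4 := pow_le_pow_left₀ ht0 ht1 4
  have ht5 : t ^ 5 ≤ (29 / 196) ^ 5 := pow_le_pow_left₀ ht0 ht1 5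
  have ht6 : t ^ 6 ≤ (29 / 196) ^ 6 := pow_le_pow_left₀ ht0 ht1 6
  nlinarith [ht2, ht3, ht4, ht5, ht6]

/-- Region one: `2(E⁶ − E² − 1) + 2E³ − (97/28) E (E⁴ − 1) ≥ 0` for `1 ≤ E ≤ 225/196`
(in `t = E − 1` this is `t/7 − 9t²/14 +` nonnegative terms, and `t ≤ 29/196 < 2/9`). -/
private lemma regionOne_poly_nonneg (E : ℝ) (h1 : 1 ≤ E) (h2 : E ≤ 225 / 196) :
    0 ≤ 2 * (E ^ 6 - E ^ 2 - 1) + 2 * E ^ 3 - 97 / 28 * (E * (E ^ 4 - 1)) := by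
  obtain ⟨t, rfl⟩ : ∃ t, E = 1 + t := ⟨E - 1, by ring⟩
  have ht0 : 0 ≤ t := by linarith
  have ht1 : t ≤ 29 / 196 := by linarith
  have k1 : 0 ≤ t * (1 / 7 - 9 / 14 * t) := mul_nonneg ht0 (by linarith)
  nlinarith [k1, pow_nonneg ht0 3, pow_nonneg ht0 4, pow_nonneg ht0 5, pow_nonneg ht0 6]

/-- Region two, endpoint `σ = 2A`: `2(E⁶ − E² − 1) + 2E³ − (279/100) E (E⁴ − 1) ≥ 0` for
`1 ≤ E` (all coefficients in `t = E − 1` are positive). -/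
private lemma regionTwo_polyPlus_nonneg (E : ℝ) (h1 : 1 ≤ E) :
    0 ≤ 2 * (E ^ 6 - E ^ 2 - 1) + 2 * E ^ 3 - 279 / 100 * (E * (E ^ 4 - 1)) := by
  obtain ⟨t, rfl⟩ : ∃ t, E = 1 + t := ⟨E - 1, by ring⟩
  have ht0 : 0 ≤ t := by linarith
  nlinarith [pow_nonneg ht0 2, pow_nonneg ht0 3, pow_nonneg ht0 4, pow_nonneg ht0 5,
    pow_nonneg ht0 6]

/-- Region two, endpoint `σ = −2A`: `−2(E⁶ − E² − 1) + 2E³ − (279/100) E (E⁴ − 1) ≥ 0` for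
`1 ≤ E ≤ 7/6` (decreasing in `t = E − 1 ∈ [0, 1/6]`, value `37141/466560 > 0` at `t = 1/6`). -/
private lemma regionTwo_polyMinus_nonneg (E : ℝ) (h1 : 1 ≤ E) (h2 : E ≤ 7 / 6) :
    0 ≤ -(2 * (E ^ 6 - E ^ 2 - 1)) + 2 * E ^ 3 - 279 / 100 * (E * (E ^ 4 - 1)) := by
  obtain ⟨t, rfl⟩ : ∃ t, E = 1 + t := ⟨E - 1, by ring⟩
  have ht0 : 0 ≤ t := by linarith
  have ht1 : t ≤ 1 / 6 := by linarith
  have ht2 : t ^ 2 ≤ (1 / 6) ^ 2 := pow_le_pow_left₀ ht0 ht1 2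
  have ht3 : t ^ 3 ≤ (1 / 6) ^ 3 := pow_le_pow_left₀ ht0 ht1 3
  have ht4 : t ^ 4 ≤ (1 / 6) ^ 4 := pow_le_pow_left₀ ht0 ht1 4
  have ht5 : t ^ 5 ≤ (1 / 6) ^ 5 := pow_le_pow_left₀ ht0 ht1 5
  have ht6 : t ^ 6 ≤ (1 / 6) ^ 6 := pow_le_pow_left₀ ht0 ht1 6
  nlinarith [ht2, ht3, ht4, ht5, ht6]

/-- Region one in the variable `E = exp (x/2) ∈ (1, 225/196]`. -/
private lemma regionOne_alg (A σ E : ℝ) (hA : 0 ≤ A) (hσ : σ ≤ 2 * A) (hE1 : 1 < E)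
    (hE2 : E ≤ 225 / 196) :
    A * (97 / 28) ≤ σ * (E⁻¹ + E) - (E * σ - 2 * A) / (2 * ((E ^ 4 - 1) / (2 * E ^ 2))) := by
  have hden : 0 < E * (E ^ 4 - 1) :=
    mul_pos (by linarith) (sub_pos.2 (one_lt_pow₀ hE1 (by norm_num)))
  have hP := weightNum_nonpos E hE1.le hE2
  have hg := regionOne_poly_nonneg E hE1.le hE2
  have hσP : 2 * A * (E ^ 6 - E ^ 2 - 1) ≤ σ * (E ^ 6 - E ^ 2 - 1) :=
    mul_le_mul_of_nonpos_right hσ hP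
  have hnum :
      0 ≤ σ * (E ^ 6 - E ^ 2 - 1) + 2 * A * E ^ 3 - 97 / 28 * A * (E * (E ^ 4 - 1)) := by
    nlinarith [mul_nonneg hA hg, hσP]
  rw [← sub_nonneg, key_identity A σ E (97 / 28) hE1]
  exact div_nonneg hnum hden.le

/-- Region two in the variable `E = exp (x/2) ∈ (1, 7/6]`. -/
private lemma regionTwo_alg (A σ E : ℝ) (hσ : |σ| ≤ 2 * A) (hE1 : 1 < E) (hE2 : E ≤ 7 / 6) :
    A * (279 / 100) ≤ σ * (E⁻¹ + E) - (E * σ - 2 * A) / (2 * ((E ^ 4 - 1) / (2 * E ^ 2))) := by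
  have hden : 0 < E * (E ^ 4 - 1) :=
    mul_pos (by linarith) (sub_pos.2 (one_lt_pow₀ hE1 (by norm_num)))
  obtain ⟨hl, hu⟩ := abs_le.1 hσ
  have h1 : 0 ≤ σ + 2 * A := by linarith
  have h2 : 0 ≤ 2 * A - σ := by linarith
  have ha := regionTwo_polyPlus_nonneg E hE1.le
  have hb := regionTwo_polyMinus_nonneg E hE1.le hE2
  have hnum :
      0 ≤ σ * (E ^ 6 - E ^ 2 - 1) + 2 * A * E ^ 3 - 279 / 100 * A * (E * (E ^ 4 - 1)) := by
    nlinarith [mul_nonneg h1 ha, mul_nonneg h2 hb]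
  rw [← sub_nonneg, key_identity A σ E (279 / 100) hE1]
  exact div_nonneg hnum hden.le

/-- Region one: `h ≥ (97/28)·A` for `0 < x ≤ 4 log(15/14)`, `σ ≤ 2A`, `A ≥ 0`. -/
private theorem regionOne (A σ x : ℝ) (hA : 0 ≤ A) (hσ : σ ≤ 2 * A) (hx : 0 < x)
    (hx1 : x ≤ 4 * Real.log (15 / 14)) :
    A * (97 / 28) ≤
      σ * (Real.exp (-(x / 2)) + Real.exp (x / 2)) -
        (Real.exp (x / 2) * σ - 2 * A) / (2 * Real.sinh x) := by
  rw [sinh_via_exp_half, Real.exp_neg]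
  set E := Real.exp (x / 2) with hE
  have hE1 : 1 < E := Real.one_lt_exp_iff.2 (by linarith)
  have hE2 : E ≤ 225 / 196 := by
    have h : x / 2 ≤ 2 * Real.log (15 / 14) := by linarith
    calc E = Real.exp (x / 2) := rfl
      _ ≤ Real.exp (2 * Real.log (15 / 14)) := Real.exp_le_exp.2 h
      _ = 225 / 196 := by
        rw [two_mul, Real.exp_add, Real.exp_log (by norm_num)]; norm_num
  exact regionOne_alg A σ E hA hσ hE1 hE2

/-- Region two: `h ≥ (279/100)·A` for `4 log(15/14) ≤ x ≤ 2 log(7/6)`, `|σ| ≤ 2A`. -/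
private theorem regionTwo (A σ x : ℝ) (_hA : 0 ≤ A) (hσ : |σ| ≤ 2 * A)
    (hx1 : 4 * Real.log (15 / 14) ≤ x) (hx2 : x ≤ 2 * Real.log (7 / 6)) :
    A * (279 / 100) ≤
      σ * (Real.exp (-(x / 2)) + Real.exp (x / 2)) -
        (Real.exp (x / 2) * σ - 2 * A) / (2 * Real.sinh x) := by
  have hx : 0 < x := by
    have := Real.log_pos (show (1 : ℝ) < 15 / 14 by norm_num)
    linarith
  rw [sinh_via_exp_half, Real.exp_neg]
  set E := Real.exp (x / 2) with hE
  have hE1 : 1 < E := Real.one_lt_exp_iff.2 (by linarith)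
  have hE2 : E ≤ 7 / 6 := by
    calc E = Real.exp (x / 2) := rfl
      _ ≤ Real.exp (Real.log (7 / 6)) := Real.exp_le_exp.2 (by linarith)
      _ = 7 / 6 := Real.exp_log (by norm_num)
  exact regionTwo_alg A σ E hσ hE1 hE2

/-- **Stub `stub_regionOneTwo`** (line `Sketch` of `SignCone.SignConeFarField`): the pointwise
minorants of `h(A, σ, x) = σ (e^{-x/2} + e^{x/2}) − (e^{x/2} σ − 2A) / (2 sinh x)` on
`(0, t₁]` (constant `97/28`, given `σ ≤ 2A`) and on `[t₁, t₂]` (constant `279/100`, given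
`|σ| ≤ 2A`), where `t₁ = 4 log(15/14)` and `t₂ = 2 log(7/6)`. -/
theorem stub_regionOneTwo :
    (∀ A σ x : ℝ, 0 ≤ A → σ ≤ 2 * A → 0 < x → x ≤ 4 * Real.log (15 / 14) →
      A * (97 / 28) ≤
        σ * (Real.exp (-(x / 2)) + Real.exp (x / 2)) -
          (Real.exp (x / 2) * σ - 2 * A) / (2 * Real.sinh x)) ∧
    (∀ A σ x : ℝ, 0 ≤ A → |σ| ≤ 2 * A → 4 * Real.log (15 / 14) ≤ x → x ≤ 2 * Real.log (7 / 6) →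
      A * (279 / 100) ≤
        σ * (Real.exp (-(x / 2)) + Real.exp (x / 2)) -
          (Real.exp (x / 2) * σ - 2 * A) / (2 * Real.sinh x)) :=
  ⟨regionOne, regionTwo⟩

end Summit.RiemannHypothesis.RiemannHypothesis.Theorems.SignConeFarField

end
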